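import Summits.AtomisticToContinuum.Crystallization.Theses.FreeSplittingCertificates
import Summits.AtomisticToContinuum.Crystallization.Theorems.ThreeConeCertificateKeplerBoundLocLimCharged

/-!
# Route `FreeSplittingCertificates`, support item `DefectVanishEnergy`
# (stmt-AtomisticToContinuum-12568)

`PeriodicUpperBound → ∀ P periodic, DefectVanish(P) → HasPeriodicGroundStateEnergy lennardJones 3`,
where `DefectVanish(P)` says: for all radii `R'` and tolerances `ε'`, along EVERY sequence of
Lennard-Jones ground states the fraction of particles whose `R'`-environment is not two-way
`ε'`-matched to `x i + A (P.points − q)` (some site `q ∈ P.points`, some linear isometry `A`)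
tends to `0`.

PROOF (no window averaging is needed, and the hypothesis `PeriodicUpperBound` is not used).
Test `DefectVanish(P)` on the canonical ground-state sequence `gs`
(`LennardJonesGroundStatesExist_holds`): the bad fraction tends to `0`, so for all large `N` some
particle of `gs N` is matched (`frequently_exists_of_tendsto_card_div`), i.e. `P` is CHARGED by
`gs` in the sense of `ThreeConeCertificateKeplerBoundLocLimCharged.lean`.  By the tree theorem
`KeplerBoundLocalLimit.energyPerParticle_le_eStar_of_charged` (reduction of the sites `q` to motif
classes, compactness of `O(3)`, and the local-limit argument "periodic local limits of translated
ground states are periodic minimisers" via the multi-particle removal inequality), `e(P) ≤ e*`,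
`e* = ⨅_Q e(Q)`; with `eStar_le` this is `IsLeast`, and `E(N)/N → e* = e(P)` is `crysEnergyLimit`
(Fekete, `BlancLewin2015_8_holds`, plus periodisation).  All `[folklore]` on top of landed files.
-/

noncomputable section

open scoped Topology
open Filter Set

namespace Summit.AtomisticToContinuum.Crystallization.Theorems

open Literature.MathematicalPhysics.StatisticalMechanics
open Summit.AtomisticToContinuum.Crystallization.Theorems.SlackRigidityNegative (E3 gs gs_isGroundState)
open Summit.AtomisticToContinuum.Crystallization.Theorems.ChargedEnergyGapNegative
  (eStar eStar_le crysEnergyLimit)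
open Summit.AtomisticToContinuum.Crystallization.Theorems.KeplerBoundLocalLimit
  (energyPerParticle_le_eStar_of_charged)
open Summit.AtomisticToContinuum.Crystallization.Theses.FreeSplittingCertificates (DefectVanishEnergy)

/-- **Counting step.** If the fraction of "bad" indices `#{i : Fin N // ¬ good N i} / N` tends to
`0`, then frequently (indeed for all large `N`) some index is good: eventually the fraction is
`< 1`, while "all bad" makes it `= 1` for `N ≥ 1`. [folklore] -/
theorem frequently_exists_of_tendsto_card_div {good : (N : ℕ) → Fin N → Prop}
    (h : Tendsto (fun N : ℕ => (Nat.card {i : Fin N // ¬ good N i} : ℝ) / N) atTop (𝓝 0)) :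
    ∃ᶠ N in atTop, ∃ i : Fin N, good N i := by
  have hev : ∀ᶠ N : ℕ in atTop, (Nat.card {i : Fin N // ¬ good N i} : ℝ) / N < 1 :=
    h.eventually (gt_mem_nhds one_pos)
  refine ((hev.and (eventually_ge_atTop 1)).mono ?_).frequently
  rintro N ⟨hlt, hN⟩
  have hNpos : (0 : ℝ) < N := by exact_mod_cast hN
  by_contra hall
  have hall' : ∀ i : Fin N, ¬ good N i := fun i hi => hall ⟨i, hi⟩
  have hcard : Nat.card {i : Fin N // ¬ good N i} = N := by
    rw [Nat.card_congr (Equiv.subtypeUnivEquiv hall'), Nat.card_fin]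
  rw [hcard, div_self hNpos.ne'] at hlt
  exact lt_irrefl _ hlt

/-- **`DefectVanishEnergy` holds** (item stmt-AtomisticToContinuum-12568 of route
`FreeSplittingCertificates`): for every periodic `P`, if along every sequence of Lennard-Jones
ground states all but `o(N)` particles carry a two-way `ε'`-matched `R'`-window of `P` (for all
`R', ε' > 0`), then `HasPeriodicGroundStateEnergy lennardJones 3` — with this very `P`:
`P` is charged by the canonical ground states `gs`, hence `e(P) ≤ e* = ⨅_Q e(Q)`
(`energyPerParticle_le_eStar_of_charged`), so `e(P)` is the least periodic energy per particle and
`E(N)/N → e* = e(P)` (`crysEnergyLimit`).  The hypothesis `PeriodicUpperBound` is not needed.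
[folklore] -/
theorem defectVanishEnergy_proof : DefectVanishEnergy := by
  unfold DefectVanishEnergy
  intro _ P hP
  -- `P` is charged by the canonical ground-state sequence `gs`
  have hcharged : ∀ R ε : ℝ, 0 < R → 0 < ε → ∃ᶠ N in atTop, ∃ (i : Fin N) (A : E3 →ₗᵢ[ℝ] E3),
      ∃ q ∈ P.points,
        (∀ s ∈ P.points, dist s q ≤ R → ∃ j, dist (gs N j) (gs N i + A (s - q)) ≤ ε) ∧
        (∀ j, dist (gs N j) (gs N i) ≤ R →
          ∃ s ∈ P.points, dist (gs N j) (gs N i + A (s - q)) ≤ ε) := by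
    intro R ε hR hε
    refine (frequently_exists_of_tendsto_card_div (hP R ε hR hε gs gs_isGroundState)).mono ?_
    rintro N ⟨i, q, hq, A, hA⟩
    exact ⟨i, A, q, hq, hA⟩
  have hle : P.energyPerParticle lennardJones ≤ eStar :=
    energyPerParticle_le_eStar_of_charged gs gs_isGroundState hcharged
  refine ⟨P, ⟨⟨P, rfl⟩, ?_⟩, ?_⟩
  · rintro _ ⟨Q, rfl⟩
    exact hle.trans (eStar_le Q)
  · have heq : P.energyPerParticle lennardJones = eStar := le_antisymm hle (eStar_le P)
    rw [heq]
    exact crysEnergyLimit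

end Summit.AtomisticToContinuum.Crystallization.Theorems

end
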